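import Summits.BirchSwinnertonDyer.BirchSwinnertonDyer.Theorems.ErratumRoadFiveNonSurjCornerAuxPrimeSupplyOfPreWitness
import Summits.BirchSwinnertonDyer.BirchSwinnertonDyer.Theorems.ErratumRoadFiveNonSurjCornerAuxPrimePreWitness
import Summits.BirchSwinnertonDyer.BirchSwinnertonDyer.Theorems.ErratumRoadFiveNonSurjCornerAuxPrimeTracePropertyCartan
import Summits.BirchSwinnertonDyer.BirchSwinnertonDyer.Theorems.ErratumRoadFiveNonSurjCornerAuxPrimeTracePropertyG9
import Summits.BirchSwinnertonDyer.BirchSwinnertonDyer.Theorems.ErratumRoadFiveNonSurjCornerFiveImageExact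
import HarnessLib

/-!
# Route `ErratumRoadFive` (rung K2), crux `NonSurjCorner` (item stmt-BirchSwinnertonDyer-19065), line `Lines/hybrid.lean`, r22 slot 6″:
# THE CORNER AUXILIARY-PRIME SUPPLY FROM K-DISJOINTNESS ALONE — assembly of (L0), (L1), (L2), (T) over lane B's exact corner images
# (cell `bsd-stepL`, seat `bsd-stepL-corner-p1` g18; `--supports stmt-BirchSwinnertonDyer-19065 --as helper`)

WHY THIS FILE. Road B (bsd-idea-9's aux-norm lever, 19715) routed item 27982 ((B6) at the carriers) out of the Euler half under `Surj`; its only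
image-dependent step is the Chebotarev–Kummer auxiliary-prime supply. This seat ported it to the (T4′) corner in pieces: (L2) Kummer descent ∕ exclusion
for images of order prime to `p` (`…AuxPrimeKummerDescent`, `…ModPImageCoprime`), the supply modulo the Frobenius pre-witness
(`…AuxPrimeSupplyOfPreWitness`), the pre-witness from K-disjointness (K) and the trace property (T) (`…AuxPrimePreWitness`), and (T) for both corner
images (`…AuxPrimeTracePropertyCartan`: `N(C_s)`; `…AuxPrimeTracePropertyG9`: Zywina's `G₉`), using lane B's KERNEL exact-image theorems
(`CornerShape.NonSurjCorner.image_five_eq_normalizer_or_eq_G9` at `5`, `CornerShape.image_eq_normalizer_splitCartan` at `p ≥ 7`). This file assembles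
them: at every corner pair and every imaginary quadratic `K` (`d_K < −4`) which is K-DISJOINT from `E[p]` — every value of `ρ̄_{E,p}` is taken on
`Γ_K`, i.e. `K ⊄ ℚ(E[p])` — the auxiliary-prime supply holds at every split prime `q`. So r22's slot 6″ (`stub_cornerAuxPrimeSupply57`) reduces to the
ONE classical statement (K) on the line's inert frames (where it follows from «`p` inert in `K`, split in the Cartan field, ramified in `ℚ(√p*)`» —
local theory at `p`, the remaining step), and item 27982 is discharged from 19065's cone modulo (K).
* `AuxPrimeSupplyCorner.cornerAuxPrimeSupply_of_rangeK`.

HONEST FRAMING: ONE THEOREM (no definition, no named fact, no `sorry`); CONDITIONAL on (K) per frame field; nothing about any curve's BSD; 19065 NOT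
closed; BSD is not advanced; T7. Credit: -w2 g5, -w4 g8, -w3, -w6 g0 (road B under `Surj`), lane B corner5-p2 g2∕g5 (exact images), bsd-idea-9.
References (locators only): [cite: GrossLMS1991, §3 (p. 239), §9] [cite: Serre1972, §2.2, §2.4 Prop. 15, §2.6] [cite: Zywina2015, §1.3, Thm. 1.4]
[cite: Cox2013, §7.D, Thm. 8.12, §9.A].
-/

noncomputable section

set_option autoImplicit false
set_option linter.dupNamespace false -- `Summit.BirchSwinnertonDyer.BirchSwinnertonDyer` (summit = problem), tree-wide

open scoped Classical NumberField Pointwise nonZeroDivisors MatrixGroups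
open WeierstrassCurve NumberField Field IsDedekindDomain Matrix
open Literature.NumberTheory.GaloisRepresentations Literature.NumberTheory.EllipticCurves
open Literature.NumberTheory.EllipticCurves.Rank1Residual Summit.BirchSwinnertonDyer.Rank1Residual
open Literature.NumberTheory.NumberFields.RingClassField Literature.NumberTheory.QuadraticFields
open Literature.NumberTheory.EllipticCurves.Zywina2015G9

namespace Summit.BirchSwinnertonDyer.BirchSwinnertonDyer.Theorems.AuxPrimeSupplyCorner

/-- **THE CORNER AUXILIARY-PRIME SUPPLY FROM K-DISJOINTNESS.** For a (T4′) corner pair (`ClassX11b W p`, `ρ̄_{E,p}` not onto, `p ∈ {5, 7}`), an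
imaginary quadratic `K` with `d_K < −4` such that every value of `ρ̄_{E,p}` on `Γ_ℚ` is taken on `res Γ_K` (K-disjointness), a prime `q` split in `K`
and `N ≠ 0`: for every exponent `E` and finite set `T` there is an inert prime `ℓ₀ ∉ T`, `ℓ₀ ∤ N`, with `p ∤ a_{ℓ₀}(E)` and `p^E ∣ ord [𝔭_v]_{ℓ₀}` at
both `v ∣ q` — the body of `AuxNormReceptacle.AuxiliaryPrimeSupply W K p q N`. Proof: frame; `p ∤ |image|` (L0); exact image (lane B) ⇒ trace property
(T); pre-witness (L1); supply (-w2 g5's argument with the corner Kummer exclusion (L2)). [cite: GrossLMS1991, §9] [cite: Zywina2015, Thm. 1.4] -/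
theorem cornerAuxPrimeSupply_of_rangeK (W : WeierstrassCurve ℚ) [W.IsElliptic] [W.IsGloballyMinimal] (p : ℕ) [Fact p.Prime]
    (hX : ClassX11b W p) (hns : ¬ Surj W p) (h57 : p = 5 ∨ p = 7)
    (K : Type) [Field K] [NumberField K] (hK : IsImaginaryQuadratic K) (hdK : NumberField.discr K < -4)
    (hKE : ∀ σ : absoluteGaloisGroup ℚ, ∃ τ : absoluteGaloisGroup ℚ,
      τ ∈ (absGaloisRestrict ℚ K).range ∧ galoisRepTorsion W p τ = galoisRepTorsion W p σ)
    (q : ℕ) [Fact q.Prime] (hq2 : ((Ideal.span {(q : ℤ)}).primesOver (𝓞 K)).ncard = 2) (N : ℕ) (hN : N ≠ 0) :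
    ∀ (E : ℕ) (T : Finset ℕ), ∃ ℓ₀ : ℕ, ℓ₀.Prime ∧ ℓ₀ ∉ T ∧ ¬ ℓ₀ ∣ N ∧
      (Ideal.span {(ℓ₀ : 𝓞 K)}).IsPrime ∧ ¬ (p : ℤ) ∣ W.frobeniusTrace ℓ₀ ∧
      ∀ v : HeightOneSpectrum (𝓞 K), ((q : ℕ) : 𝓞 K) ∈ v.asIdeal →
        p ^ E ∣ orderOf (primeClass ℓ₀ v) := by
  have hp5 : 5 ≤ p := by rcases h57 with rfl | rfl <;> norm_num
  have hirr : W.HasIrreducibleModPGaloisRep p := hX.2.2.2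
  have hmult : Mult W p := hX.2.2.1
  have hns' : ¬ W.HasSurjectiveModNGaloisRep p := hns
  have hcop := NonSurjCorner.not_dvd_card_range_galoisRepTorsion_of_irr_of_not_surj W hirr hns'
  obtain ⟨e, Φ, he, htr, hdet, -, -⟩ := W.exists_frame_galoisRepTorsion_rat p
  -- (T) from the exact image
  have hT : ∀ g : absoluteGaloisGroup ℚ, ∃ σ₀ : absoluteGaloisGroup ℚ,
      Matrix.GeneralLinearGroup.det (Φ (galoisRepTorsion W p σ₀)) = 1 ∧
      Matrix.trace ((Φ (galoisRepTorsion W p (g * σ₀)) : GL (Fin 2) (ZMod p)) : Matrix (Fin 2) (Fin 2) (ZMod p)) ≠ 0 := by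
    rcases h57 with rfl | rfl
    · rcases CornerShape.NonSurjCorner.image_five_eq_normalizer_or_eq_G9 W hX hns Φ e he with ⟨P, hG⟩ | ⟨P, hG⟩
      · exact traceProperty_of_image_eq_normalizer_splitCartan W hp5 Φ hG
      · exact traceProperty_of_image_eq_map_G9 W Φ hG
    · obtain ⟨P, hG⟩ := CornerShape.image_eq_normalizer_splitCartan W 7 Φ e he le_rfl hmult hirr hns
      exact traceProperty_of_image_eq_normalizer_splitCartan W hp5 Φ hG
  -- (L1) the pre-witness, then the supply
  exact auxiliaryPrimeSupply_of_preWitness W K hK hdK p hp5 hirr hns'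
    (fun hE _ hζ ↦ exists_preWitness_of_rangeK W hK Φ htr hdet hcop hKE hT hE hζ) q hq2 N hN

end Summit.BirchSwinnertonDyer.BirchSwinnertonDyer.Theorems.AuxPrimeSupplyCorner

end
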